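import Summits.BirchSwinnertonDyer.BirchSwinnertonDyer.Theses.ByReductionTypeAtTwo
import Literature.NumberTheory.EllipticCurves.GaloisAction
import HarnessLib

/-! # Birth skeleton v2 (BC3/BC5 plan-only) for K4 crux `OrdKatoHalfAtTwoIso`
(item stmt-BirchSwinnertonDyer-19573, rider K-1/β; planner bsd-2adic-plan GEN 13 → GEN 14, 2026-08-26).
Two registered stubs by RESIDUAL IMAGE at 2 and ONE kernel-checked CLOSED composition `OrdKatoHalfAtTwoIso_of`
over the stub names (v1 failed `skeleton.extra-hypothesis`: its composition took the stub STATEMENTS as anonymous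
hypotheses; the checker admits only registered obligations BY NAME). -/

set_option autoImplicit false
-- the Cruxes namespace of this sub repeats the summit name by design (D-0017 nested layout)
set_option linter.dupNamespace false

namespace Summit.BirchSwinnertonDyer.BirchSwinnertonDyer.Cruxes.OrdKatoHalfAtTwoIso.Birth

open WeierstrassCurve Literature.NumberTheory.EllipticCurves Literature.NumberTheory.EllipticCurves.Rank1Residual
  Summit.BirchSwinnertonDyer.BirchSwinnertonDyer.Theses.ByReductionTypeAtTwo

/-- stub (surjective image, «Lemma S» regime): ρ̄_{E,2} surjective ⇒ the Kato half AT W ITSELF (integral Kato divisibility at 2;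
the input Kato 17.4(3) lacks at p = 2 is 12.5.2 — the first rung is the GVI seed classes with E[2] irreducible, e.g. 32505h1
`…GVISeed.mainConjectureLowerDivisibilityAtTwoOrd_32505h1`). -/
theorem stub_surj : ∀ (W : WeierstrassCurve ℚ) [W.IsElliptic] [W.IsGloballyMinimal], ¬ W.HasCM → W.analyticRank = 0 →
    GoodOrd W 2 → W.HasSurjectiveModNGaloisRep 2 →
    Summit.BirchSwinnertonDyer.Rank1Residual.X5.O1.MainConjectureLowerDivisibilityAtTwoOrd W := by
  sorry

/-- stub (non-surjective image): some ISOGENOUS globally minimal member carries the Kato half (GV μ-transport to the μ-minimal /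
Prop-5.14 member of the class; T-42 at 2 for reducible E[2] is the open input). -/
theorem stub_nonsurj_iso : ∀ (W : WeierstrassCurve ℚ) [W.IsElliptic] [W.IsGloballyMinimal], ¬ W.HasCM → W.analyticRank = 0 →
    GoodOrd W 2 → ¬ W.HasSurjectiveModNGaloisRep 2 →
    ∃ (W' : WeierstrassCurve ℚ) (_ : W'.IsElliptic) (_ : W'.IsGloballyMinimal), WeierstrassCurve.IsIsogenous W W' ∧
      Summit.BirchSwinnertonDyer.Rank1Residual.X5.O1.MainConjectureLowerDivisibilityAtTwoOrd W' := by
  sorry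

/-- composition (CLOSED over the two stub names; the ONLY theorem of this file concluding the crux):
the two image regimes exhaust the class. -/
theorem OrdKatoHalfAtTwoIso_of : OrdKatoHalfAtTwoIso := by
  intro W _ _ hcm hr hgo
  by_cases h : W.HasSurjectiveModNGaloisRep 2
  · exact ⟨W, inferInstance, inferInstance, WeierstrassCurve.isIsogenous_self W, stub_surj W hcm hr hgo h⟩
  · exact stub_nonsurj_iso W hcm hr hgo h

end Summit.BirchSwinnertonDyer.BirchSwinnertonDyer.Cruxes.OrdKatoHalfAtTwoIso.Birth
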